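import Summits.SmoothPoincare4.SmoothPoincare4.Theorems.DottedCircleRasmussenDcrGapHelperHandlebodyChartModelHandlesInflateFlow

/-!
# Helper `helper_handlebodyChart_modelHandles` (M3: handle structure of the model dotted handlebody `D_k`)
# of line `mk_friends` for crux `DcrGap` — inflation of the holes, part 3: the stage
(item stmt-SmoothPoincare4-16128, route route-SmoothPoincare4-DottedCircleRasmussen)

**Registered piece `helper_handlebodyChart_modelHandles_inflate` of the model lemma M3.**  The third stage
of the squeeze of part 2 of the data stub `helper_handlebodyChart_modelHandles_data`, in the form consumed
by the composition lemma `…ModelHandlesSqueezeComp`: a diffeomorphism `κ` of `ℝ⁴` (the time-`1` map of the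
inflation flow of `…ModelHandlesInflateFlow`), the identity off a compact subset of `D_k`, commuting with
the rotations of the `w`-plane, fixing `w`, carrying `D_k ∩ {G_k ≤ 24/25}` into itself with all hole terms
`≥ 11/4` (the shadows pushed beyond the stall layers of the final radial flow), together with smooth
rotation-invariant lifts near `D_k ∩ {G_k ≤ 24/25}` of the angles swept about the hole centres
(`…ModelHandlesFlowPhase`: along the orbits every hole centre stays at distance `≥ 1`).

No definitions, no named facts, no `sorry`.  References: J. Milnor, *Morse Theory* (1963), §3
[Milnor1963].
-/

-- the prescribed namespace `Summit.<P>.<Sub>.…` duplicates `SmoothPoincare4` (P = Sub)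
set_option linter.dupNamespace false
set_option linter.style.longLine false

noncomputable section

open scoped Manifold ContDiff Topology
open Function Set Metric Filter
open Literature.Topology.FourManifolds Literature.Topology.FourManifolds.MMSW
open Literature.AlgebraicTopology.Homotopy.HopfFibration

namespace Summit.SmoothPoincare4.SmoothPoincare4.Theorems.DcrGap.MkFriends

namespace ModelHandles

/-- **The inflation of the holes** (stage form of `exists_inflate_flow`, with swept angles): a
diffeomorphism of `ℝ⁴`, the identity off a compact subset of `D_k`, commuting with the rotations of the
`w`-plane and fixing `w`, carrying `D_k ∩ {G_k ≤ 24/25}` into itself with all hole terms `≥ 11/4`, with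
smooth rotation-invariant lifts near `D_k ∩ {G_k ≤ 24/25}` of the angles swept about the hole centres.
[folklore] -/
theorem exists_inflate (k : ℕ) :
    ∃ (κ : EuclideanSpace ℝ (Fin 4) ≃ₘ⟮𝓡 4, 𝓡 4⟯ EuclideanSpace ℝ (Fin 4))
      (K N₀ : Set (EuclideanSpace ℝ (Fin 4))) (SW : Fin k → EuclideanSpace ℝ (Fin 4) → ℝ),
      IsCompact K ∧ K ⊆ modelHandlebody k ∧ (∀ x, x ∉ K → κ x = x) ∧
      (∀ u : ℂ, ‖u‖ = 1 → ∀ x, κ (fibreRot (fun _ => u) x) = fibreRot (fun _ => u) (κ x)) ∧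
      (∀ x, wC (κ x) = wC x) ∧
      (∀ x ∈ modelHandlebody k, levelFun k x ≤ 24 / 25 →
        κ x ∈ modelHandlebody k ∧ levelFun k (κ x) ≤ 24 / 25 ∧ ∀ j, 11 / 4 ≤ holeTerm k j (κ x)) ∧
      IsOpen N₀ ∧ {x | x ∈ modelHandlebody k ∧ levelFun k x ≤ 24 / 25} ⊆ N₀ ∧
      (∀ l, ContDiffOn ℝ ∞ (SW l) N₀) ∧
      (∀ l (u : ℂ), ‖u‖ = 1 → ∀ x, SW l (fibreRot (fun _ => u) x) = SW l x) ∧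
      ∀ l, ∀ x ∈ {x | x ∈ modelHandlebody k ∧ levelFun k x ≤ 24 / 25},
        (zC (κ x) - holeCentre k l) / ((‖zC (κ x) - holeCentre k l‖ : ℝ) : ℂ) =
          Complex.exp ((SW l x : ℂ) * Complex.I) *
            ((zC x - holeCentre k l) / ((‖zC x - holeCentre k l‖ : ℝ) : ℂ)) := by
  obtain ⟨θ, V, K, hθs, h0, -, hint, hVc, hKc, hKD, hVK, hfixK, hstage, hcomm, -, -, hw, horbit⟩ :=
    exists_inflate_flow k
  -- velocity bound
  obtain ⟨M, hM0, hM⟩ : ∃ M : ℝ, 0 < M ∧ ∀ y, ‖V y‖ ≤ M := by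
    obtain ⟨C, hC⟩ := hKc.exists_bound_of_continuousOn hVc.continuousOn
    refine ⟨max C 0 + 1, by positivity, fun y => ?_⟩
    by_cases hy : y ∈ K
    · exact (hC y hy).trans (by linarith [le_max_left C 0])
    · rw [hVK y hy, norm_zero]; positivity
  -- the swept angles
  have hfar : ∀ x ∈ {x | x ∈ modelHandlebody k ∧ levelFun k x ≤ 24 / 25}, ∀ t : ℝ, 0 ≤ t → t ≤ 1 →
      ∀ l : Fin k, (1 : ℝ) ≤ ‖zC (θ (t, x)) - holeCentre k l‖ := by
    intro x hx t ht _ l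
    have h := ((horbit x hx.1 hx.2).1 t ht).1.1 l
    rw [holeTerm_eq_normSq, Complex.normSq_eq_norm_sq] at h
    nlinarith [norm_nonneg (zC (θ (t, x)) - holeCentre k l)]
  obtain ⟨N₀, SW, hN₀o, hSN, hSWs, hSWrot, hsw⟩ :=
    flow_phase k hθs h0 hint hM hM0 zero_le_one one_pos hcomm hfar
  -- the stage
  obtain ⟨Φ, hΦ⟩ := hstage 1
  refine ⟨Φ, K, N₀, SW, hKc, hKD, fun x hx => ?_, fun u hu x => ?_, fun x => ?_, fun x hx hG => ?_,
    hN₀o, hSN, hSWs, hSWrot, fun l x hx => ?_⟩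
  · rw [hΦ]; exact hfixK x hx _
  · rw [hΦ, hΦ]; exact hcomm u hu _ _
  · rw [hΦ]; exact hw x 1
  · rw [hΦ]
    obtain ⟨h1, h2⟩ := horbit x hx hG
    exact ⟨(h1 1 zero_le_one).1, (h1 1 zero_le_one).2, h2⟩
  · rw [hΦ]; exact hsw l x hx

end ModelHandles

/-- **Registered piece `helper_handlebodyChart_modelHandles_inflate` of the model lemma M3 (the inflation
of the holes, stage form)**: a diffeomorphism of `ℝ⁴`, the identity off a compact subset of `D_k`, commuting
with the rotations of the `w`-plane and fixing `w`, carrying `D_k ∩ {G_k ≤ 24/25}` into itself with all hole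
terms `≥ 11/4`, with smooth rotation-invariant lifts of the swept angles (`ModelHandles.exists_inflate`).
[folklore] -/
theorem helper_handlebodyChart_modelHandles_inflate : ∀ (k : ℕ), ∃ (κ : EuclideanSpace ℝ (Fin 4) ≃ₘ⟮𝓡 4, 𝓡 4⟯ EuclideanSpace ℝ (Fin 4)) (K N₀ : Set (EuclideanSpace ℝ (Fin 4))) (SW : Fin k → EuclideanSpace ℝ (Fin 4) → ℝ), IsCompact K ∧ K ⊆ Literature.Topology.FourManifolds.MMSW.modelHandlebody k ∧ (∀ x, x ∉ K → κ x = x) ∧ (∀ u : ℂ, ‖u‖ = 1 → ∀ x, κ (Literature.Topology.FourManifolds.MMSW.fibreRot (fun _ => u) x) = Literature.Topology.FourManifolds.MMSW.fibreRot (fun _ => u) (κ x)) ∧ (∀ x, Literature.AlgebraicTopology.Homotopy.HopfFibration.wC (κ x) = Literature.AlgebraicTopology.Homotopy.HopfFibration.wC x) ∧ (∀ x ∈ Literature.Topology.FourManifolds.MMSW.modelHandlebody k, Literature.Topology.FourManifolds.MMSW.levelFun k x ≤ 24 / 25 → κ x ∈ Literature.Topology.FourManifolds.MMSW.modelHandlebody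 k ∧ Literature.Topology.FourManifolds.MMSW.levelFun k (κ x) ≤ 24 / 25 ∧ ∀ j, 11 / 4 ≤ Literature.Topology.FourManifolds.MMSW.holeTerm k j (κ x)) ∧ IsOpen N₀ ∧ {x : EuclideanSpace ℝ (Fin 4) | x ∈ Literature.Topology.FourManifolds.MMSW.modelHandlebody k ∧ Literature.Topology.FourManifolds.MMSW.levelFun k x ≤ 24 / 25} ⊆ N₀ ∧ (∀ l, ContDiffOn ℝ ((⊤ : ℕ∞) : WithTop ℕ∞) (SW l) N₀) ∧ (∀ l (u : ℂ), ‖u‖ = 1 → ∀ x, SW l (Literature.Topology.FourManifolds.MMSW.fibreRot (fun _ => u) x) = SW l x) ∧ ∀ l, ∀ x ∈ {x : EuclideanSpace ℝ (Fin 4) | x ∈ Literature.Topology.FourManifolds.MMSW.modelHandlebody k ∧ Literature.Topology.FourManifolds.MMSW.levelFun k x ≤ 24 / 25}, (Literature.AlgebraicTopology.Homotopy.HopfFibration.zC (κ x) - Literature.Topology.FourManifolds.MMSW.holeCentre k l) / ((‖Literature.AlgebraicTopology.Homotopy.HopfFibration.zC (κ x) - Literature.Topology.FourManifolds.MMSW.holeCentre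 k l‖ : ℝ) : ℂ) = Complex.exp ((SW l x : ℂ) * Complex.I) * ((Literature.AlgebraicTopology.Homotopy.HopfFibration.zC x - Literature.Topology.FourManifolds.MMSW.holeCentre k l) / ((‖Literature.AlgebraicTopology.Homotopy.HopfFibration.zC x - Literature.Topology.FourManifolds.MMSW.holeCentre k l‖ : ℝ) : ℂ)) :=
  fun k => ModelHandles.exists_inflate k

end Summit.SmoothPoincare4.SmoothPoincare4.Theorems.DcrGap.MkFriends

end
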